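import Summits.QuantumFields.BalabanUV.T4Continuum.Support.VariationalCovariantScalarPairClosed
import Summits.QuantumFields.BalabanUV.T4Continuum.Support.VariationalCovariantRate

/-!
# T⁴ programme, spine node NE2 (U1a), lane P2 — THE FLAT WITNESS: the closed canonical-pair bracket and the tower END of the
# variational route's background tier are NON-VACUOUS — at `U = 1` (unit phases, unit transports, unit frames) EVERY data binder of
# `VariationalCovariantScalarPairClosed.scalar_pair_closed` is inhabited, the FED⁺-side defect vanishes, and the kernel derives the `L⁻²`
# rate of the scalar block-spin effective Laplacian tower UNCONDITIONALLY
# (cell `pub-balaban`, NE2 formalisation swarm, unit `b2b-balaban-t4-ne2-formalise-leaf-02` gen 3; consumes `scalar_pair_closed` (leaf-09 gen 3,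
# p213521) and the road owner's `VariationalCovariantRate.towerLimitRate_effSc_of_pairs` (p213875) BY NAME)

HONEST FRAMING (T4-DAG p. 1).  Rung (B)+1 only — NOT infinite volume, NOT a mass gap, NOT Clay.  Node NE2 is NOT IN PRINT and NOT
proved here.  This file is a SATISFIABILITY / CONSISTENCY WITNESS for the binder list of the route's END, not new analysis: the data are
the trivial ones (`Rc = R′ = 1`, `T = T′ = 1`, frames `G = G′ = 1`, block phases `c = c′ = 1`, all defects `m_G = m_B = m = w = a = m₁ = 0`),
for which the three small-field absorptions hold trivially.  What comes out is the `U = 1` (A = 0) rate class `θ = L⁻²` of the effective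
Laplacians of the transported block averages of the charged scalar — printed CONTEXT only: [King1986] Prop. 3.10 / Lemma 4.3 (the tree's
`King1986/EffectiveLaplacianRate` is a different, Fourier proof; NO identification of the two objects is asserted here); the lineage's numerics
N-ne2p2g10-1 see `‖X_{k+1} − X_k‖ ≈ 82·L^{−2k}` at `U = 1`.  [folklore] bookkeeping; nothing printed is a hypothesis; no `def … : Prop` fact;
no `sorry`; axioms standard.  HONEST DEPENDENCY (cell, verbatim): continuum YM on T⁴ ⇐ BetaPertH ∧ nine spine estimates (0/9 proved);
BetaPertH ⇐ (D1) ∧ (D4) ∧ CAP+tail; G-an2-4 gates asym, D1 and NE2/3/4.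

CONTENTS.  §1 flat data: `piT_one`, `mis_one`, `compT_one`, `Rtr_one`; §2 the flat constants `LamC0 d = 20d·36^d` (UB⁺ at `w = 0`),
`eps0 d n L = (d/4+½)·L/n²` (ONE′ at `m₁ = 0`), `ePFlat d n L = eps0·(2·LamC0)·(LamC0 + eps0·2LamC0·(LamC0+1) + 1)` and
**`scalar_pair_closed_flat`**: `Δ′_k(μ) ≤ Δ′_{k+1}(μ)` (the FED⁺ defect is ZERO — Federbush's «averaging decreases the action» recovered with
constant exactly 1) and `Δ′_{k+1}(μ) ≤ Δ′_k(μ) + ePFlat·nsq μ`, NO hypothesis; §3 `eps0_pow_eq`, `ePFlat_le` (`ePFlat d (L^k) L ≤ Cflat d L·(L⁻²)^k`);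
§4 **`towerLimitRate_scalar_flat (hL : 2 ≤ L) (ha : 0 < a) : TowerLimitRate (fun _ ↦ 1) 1 (k ↦ effSc (L^k) M 1 1 a) (Cflat d L) (L⁻²)`**
— the whole chain (P⁺ frames, FED⁺ mismatch, UB⁺, ONE′, REG⁺, COMP⁺, leaf D, the tower transport, the owner's rate plumbing) JOINTLY
INHABITED and kernel-run at `U = 1`.
-/

noncomputable section

open scoped Matrix ComplexConjugate ComplexOrder Matrix.Norms.L2Operator BigOperators

namespace Summit.QuantumFields.BalabanUV.T4Continuum.VariationalCovariantFlatWitness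

open Summit.QuantumFields.BalabanUV.T4Continuum.VariationalTransfer (blockSpin)
open Summit.QuantumFields.BalabanUV.T4Continuum.CovariantAveragingTower (TowerLimitRate)
open Summit.QuantumFields.BalabanUV.T4Continuum.VariationalCovariantEffective (effSc)
open Summit.QuantumFields.BalabanUV.T4Continuum.VariationalCovariantTower (compT Rtr)
open Summit.QuantumFields.BalabanUV.T4Continuum.VariationalCovariantScalarPairClosed (scalar_pair_closed)
open Summit.QuantumFields.BalabanUV.T4Continuum.VariationalCovariantRate (towerLimitRate_effSc_of_pairs)
open Literature.MathematicalPhysics.QuantumFieldTheory.Balaban1983to89.B5Prop11Lower (nsq nsq_nonneg)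
open Literature.MathematicalPhysics.QuantumFieldTheory.Balaban1983to89.B5Prop11Plancherel (Tor fine unitVec)
open Literature.MathematicalPhysics.QuantumFieldTheory.Balaban1983to89.B5Block118 (bpt)
open Summit.QuantumFields.BalabanUV.T4Continuum.VariationalCovariantFederbush (piT mis)
open Summit.QuantumFields.BalabanUV.T4Continuum.VariationalCovariantScalarPair (Sc Sf qW Qk Q1 qW_le_coarse)

variable {d : ℕ}

/-! ## §1 Flat data -/

section FlatData

variable (L : ℕ) [NeZero L] (N : Fin d → ℕ) [∀ μ, NeZero (N μ)]

omit [NeZero L] [∀ μ, NeZero (N μ)] in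
/-- straight path transporters of unit phases are `1`. [folklore] -/
theorem piT_one (x : Tor (fine L N)) (μ : Fin d) (t : ℕ) : piT L N (fun _ _ => (1 : ℂ)) x μ t = 1 := by
  induction t with
  | zero => rfl
  | succ t ih => simp [piT, ih]

omit [NeZero L] [∀ μ, NeZero (N μ)] in
/-- the one-block transport mismatch of unit data vanishes. [folklore] -/
theorem mis_one (y : Tor N) (μ : Fin d) (j : Fin d → Fin L) :
    mis L N (fun _ _ => (1 : ℂ)) (fun _ _ => (1 : ℂ)) (fun _ => (1 : ℂ)) y μ j = 0 := by
  simp [mis, piT_one]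

variable (n : ℕ) [NeZero n] (M : Fin d → ℕ) [hM : ∀ μ, NeZero (M μ)]

/-- composite transports of unit transports are unit. [folklore] -/
theorem compT_one : compT n L M (fun _ => (1 : ℂ)) (fun _ => (1 : ℂ)) = fun _ => (1 : ℂ) := by
  funext x; simp [compT]

omit [NeZero L] [NeZero n] hM in
/-- unit phases read on the finer torus are unit. [folklore] -/
theorem Rtr_one : Rtr n L M (fun _ _ => (1 : ℂ)) = fun _ _ => (1 : ℂ) := by
  funext x μ; simp [Rtr]

end FlatData

/-! ## §2 The closed bracket at flat data — no hypothesis -/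

/-- the flat UB⁺ constant `Λc0 = 2d·36^d·((1 + n·0)² + 9) = 20d·36^d`. [folklore] -/
def LamC0 (d : ℕ) : ℝ := 2 * d * (36 : ℝ) ^ d * 10

/-- the flat ONE′ consistency parameter `ε₁ = (d/4 + ½)·L/n²`. [folklore] -/
def eps0 (d n L : ℕ) : ℝ := ((d : ℝ) / 4 + 1 / 2) * ((L : ℝ) / (n : ℝ) ^ 2)

/-- the flat ONE′/REG⁺-side defect `e′ = ε₁·C_R·(Λ+1)` with `C_R = 2Λc0`, `Λ = Λc0 + ε₁·2Λc0·(Λc0+1)` (the `let`s of `scalar_pair_closed` at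
zero defects, `δ′ = 0`). [folklore] -/
def ePFlat (d n L : ℕ) : ℝ :=
  eps0 d n L * (2 * LamC0 d) * (LamC0 d + eps0 d n L * (2 * LamC0 d) * (LamC0 d + 1) + 1)

/-- `LamC0 ≥ 0`. [folklore] -/
theorem LamC0_nonneg (d : ℕ) : 0 ≤ LamC0 d := by unfold LamC0; positivity

/-- `eps0 ≥ 0`. [folklore] -/
theorem eps0_nonneg (d n L : ℕ) : 0 ≤ eps0 d n L := by unfold eps0; positivity

/-- `ePFlat ≥ 0`. [folklore] -/
theorem ePFlat_nonneg (d n L : ℕ) : 0 ≤ ePFlat d n L := by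
  have := LamC0_nonneg d; have := eps0_nonneg d n L
  unfold ePFlat; positivity

section Flat

variable (n L : ℕ) [NeZero n] [NeZero L] (M : Fin d → ℕ) [hM : ∀ μ, NeZero (M μ)]

/-- **THE CLOSED CANONICAL-PAIR BRACKET AT `U = 1`, NO HYPOTHESIS**: for unit phases and unit transports (unit frames, all defects `0`)
`scalar_pair_closed` gives `Δ′_k(μ) ≤ Δ′_{k+1}(μ)` — the FED⁺ defect VANISHES (Federbush's «averaging decreases the action», constant exactly
`1`) — and `Δ′_{k+1}(μ) ≤ Δ′_k(μ) + ePFlat·nsq μ` with `ePFlat = ε₁·2Λc0·(Λc0 + ε₁·2Λc0(Λc0+1) + 1)`, `ε₁ = (d/4+½)L/n²`, `Λc0 = 20d·36^d`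
(`Δ′_k := blockSpin (Qk n M 1) (Sc n M 1)`, `Δ′_{k+1} := blockSpin (Qk n M 1 ∘ Q1 n L M 1) (Sf n L M 1)`). [folklore] -/
theorem scalar_pair_closed_flat (μ : Tor M → ℂ) :
    blockSpin (Qk n M fun _ => (1 : ℂ)) (Sc n M fun _ _ => (1 : ℂ)) μ
        ≤ blockSpin ((Qk n M fun _ => (1 : ℂ)) ∘ Q1 n L M fun _ => (1 : ℂ)) (Sf n L M fun _ _ => (1 : ℂ)) μ ∧
      blockSpin ((Qk n M fun _ => (1 : ℂ)) ∘ Q1 n L M fun _ => (1 : ℂ)) (Sf n L M fun _ _ => (1 : ℂ)) μ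
        ≤ blockSpin (Qk n M fun _ => (1 : ℂ)) (Sc n M fun _ _ => (1 : ℂ)) μ + ePFlat d n L * nsq μ := by
  have h := scalar_pair_closed n L M (Rc := fun _ _ => (1 : ℂ)) (R' := fun _ _ => (1 : ℂ)) (T := fun _ => (1 : ℂ))
    (G := fun _ => (1 : ℂ)) (T' := fun _ => (1 : ℂ)) (G' := fun _ => (1 : ℂ)) (c := fun _ => (1 : ℂ)) (c' := fun _ => (1 : ℂ))
    (fun x => by simp) (fun z => by simp) (mG := 0) (mB := 0) (fun x μ => by simp) (fun z j => by simp) (by norm_num)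
    (fun x => by simp) (fun y => by simp) (mG' := 0) (mB' := 0) (fun x μ => by simp) (fun y j => by simp) (by norm_num)
    (fun x μ => by simp) (fun x => by simp) (m := 0) le_rfl (fun y μ j => by rw [mis_one]; simp) (by norm_num)
    (fun x => by simp) (fun y μ => by simp) (w := 0) le_rfl (fun y j μ _ => by simp) (a := 0) le_rfl (fun x μ ν => by simp)
    (m₁ := 0) le_rfl (fun y j μ _ => by simp) (fun y j μ _ => by simp) μ
  simp only [mul_zero, zero_mul, add_zero, ne_eq, OfNat.ofNat_ne_zero, not_false_eq_true, zero_pow, one_pow] at h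
  norm_num at h
  obtain ⟨h1, h2⟩ := h
  refine ⟨h1, h2.trans (le_of_eq ?_)⟩
  unfold ePFlat eps0 LamC0
  ring

end Flat

/-! ## §3 The flat defect is geometric with ratio `L⁻²` -/

/-- `eps0 d (L^k) L = (d/4+½)·L·((L²)⁻¹)^k`. [folklore] -/
theorem eps0_pow_eq (d L k : ℕ) : eps0 d (L ^ k) L = ((d : ℝ) / 4 + 1 / 2) * L * (((L : ℝ) ^ 2)⁻¹) ^ k := by
  unfold eps0
  push_cast
  rw [← pow_mul, mul_comm k 2, pow_mul, ← inv_pow, div_eq_mul_inv]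
  ring

/-- the tower constant of the flat witness: `Cflat = (d/4+½)·L·2Λc0·(Λc0 + (d/4+½)L·2Λc0(Λc0+1) + 1)`. [folklore] -/
def Cflat (d L : ℕ) : ℝ :=
  ((d : ℝ) / 4 + 1 / 2) * L * (2 * LamC0 d) * (LamC0 d + ((d : ℝ) / 4 + 1 / 2) * L * (2 * LamC0 d) * (LamC0 d + 1) + 1)

/-- `Cflat ≥ 0`. [folklore] -/
theorem Cflat_nonneg (d L : ℕ) : 0 ≤ Cflat d L := by
  have := LamC0_nonneg d; unfold Cflat; positivity

/-- **`ePFlat d (L^k) L ≤ Cflat d L·((L²)⁻¹)^k`** for `1 ≤ L`. [folklore] -/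
theorem ePFlat_le {L : ℕ} (hL : 1 ≤ L) (d k : ℕ) : ePFlat d (L ^ k) L ≤ Cflat d L * (((L : ℝ) ^ 2)⁻¹) ^ k := by
  have hL1 : (1 : ℝ) ≤ L := by exact_mod_cast hL
  have hΛ := LamC0_nonneg d
  set ρ : ℝ := ((L : ℝ) ^ 2)⁻¹ with hρ
  have hρ0 : 0 ≤ ρ := by positivity
  have hρ1 : ρ ≤ 1 := inv_le_one_of_one_le₀ (by nlinarith)
  have hρk : ρ ^ k ≤ 1 := pow_le_one₀ hρ0 hρ1
  set E : ℝ := ((d : ℝ) / 4 + 1 / 2) * L with hE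
  have hE0 : 0 ≤ E := by positivity
  have heps : eps0 d (L ^ k) L = E * ρ ^ k := eps0_pow_eq d L k
  have hepsE : eps0 d (L ^ k) L ≤ E := by
    rw [heps]; exact mul_le_of_le_one_right hE0 hρk
  have hK : LamC0 d + eps0 d (L ^ k) L * (2 * LamC0 d) * (LamC0 d + 1) + 1
      ≤ LamC0 d + E * (2 * LamC0 d) * (LamC0 d + 1) + 1 := by
    have := mul_le_mul_of_nonneg_right (mul_le_mul_of_nonneg_right hepsE (by positivity : 0 ≤ 2 * LamC0 d))
      (by positivity : 0 ≤ LamC0 d + 1)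
    linarith
  have hK0 : 0 ≤ LamC0 d + eps0 d (L ^ k) L * (2 * LamC0 d) * (LamC0 d + 1) + 1 := by
    have := eps0_nonneg d (L ^ k) L; positivity
  unfold ePFlat Cflat
  calc eps0 d (L ^ k) L * (2 * LamC0 d) * (LamC0 d + eps0 d (L ^ k) L * (2 * LamC0 d) * (LamC0 d + 1) + 1)
      ≤ eps0 d (L ^ k) L * (2 * LamC0 d) * (LamC0 d + E * (2 * LamC0 d) * (LamC0 d + 1) + 1) :=
        mul_le_mul_of_nonneg_left hK (mul_nonneg (eps0_nonneg d (L ^ k) L) (by positivity))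
    _ = E * (2 * LamC0 d) * (LamC0 d + E * (2 * LamC0 d) * (LamC0 d + 1) + 1) * ρ ^ k := by rw [heps]; ring

/-! ## §4 The unconditional `L⁻²` tower law at `U = 1` -/

section Tower

variable (L : ℕ) [NeZero L] (M : Fin d → ℕ) [hM : ∀ μ, NeZero (M μ)]

/-- **THE FLAT WITNESS — the variational route's END run at `U = 1` with NO hypothesis beyond `2 ≤ L`, `0 < a`**:
`TowerLimitRate (fun _ ↦ 1) 1 (k ↦ effSc (L^k) M 1 1 a) (Cflat d L) (L⁻²)` — the Hermitian effective Laplacians of the plain block averages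
of the free scalar CONVERGE on the unit torus at rate `L⁻²`, through EXACTLY the chain the background tier uses (P⁺ frames, FED⁺ mismatch,
UB⁺, ONE′, REG⁺ via `scalar_pair_closed`; COMP⁺, leaf D and the tower transport via `towerLimitRate_effSc_of_pairs`).  Every data binder of
the END is thereby JOINTLY INHABITED.  Context only: [King1986] Prop. 3.10 (A = 0 rate); no identification asserted. [folklore] -/
theorem towerLimitRate_scalar_flat (hL : 2 ≤ L) {a : ℝ} (ha : 0 < a) :
    TowerLimitRate (ι := fun _ => Tor M) (fun _ => (1 : Matrix (Tor M) (Tor M) ℂ)) 1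
      (fun k => effSc (L ^ k) M (fun _ _ => (1 : ℂ)) (fun _ => (1 : ℂ)) a) (Cflat d L) (((L : ℝ) ^ 2)⁻¹) := by
  have hL1 : 1 ≤ L := le_trans (by norm_num) hL
  have hLr : (1 : ℝ) < L := by exact_mod_cast (lt_of_lt_of_le one_lt_two hL : 1 < L)
  have hρ1 : ((L : ℝ) ^ 2)⁻¹ < 1 := inv_lt_one_of_one_lt₀ (by nlinarith)
  refine towerLimitRate_effSc_of_pairs L M (fun _ => fun _ _ => (1 : ℂ)) (fun _ => fun _ => (1 : ℂ))
    (fun _ => fun _ _ => (1 : ℂ)) (fun _ => fun _ => (1 : ℂ)) (fun k x => by simp) (CP := fun _ => 1088 * d + 128)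
    (fun k f => qW_le_coarse (L ^ k) M (G := fun _ => (1 : ℂ)) (c := fun _ => (1 : ℂ)) (mG := 0) (mB := 0)
      (fun x => by simp) (fun z => by simp) (fun x μ => by simp) (fun z j => by simp) (by norm_num) f)
    (fun k => (compT_one L (L ^ k) M).symm) (fun k => (Rtr_one L (L ^ k) M).symm) ha (Cflat_nonneg d L) (by positivity) hρ1
    (fun _ => 0) (fun k => ePFlat d (L ^ k) L)
    (fun k => mul_nonneg (Cflat_nonneg d L) (by positivity)) (fun k => ePFlat_le hL1 d k) fun k μ => ?_
  obtain ⟨h1, h2⟩ := scalar_pair_closed_flat (L ^ k) L M μ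
  exact ⟨by simpa using h1, h2⟩

end Tower

end Summit.QuantumFields.BalabanUV.T4Continuum.VariationalCovariantFlatWitness

end
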